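import Summits.ResolutionOfSingularities.Statement
import Mathlib

/-!
# ResolutionOfSingularities / Valuative — assembly

Route `ResolutionOfSingularities/Valuative` (Zariski's programme: local uniformization along every
valuation of the function field, then patching), item `stmt-ResolutionOfSingularities-0559`
(assembly). With, for every prime `p`, Zariski local uniformization `LU_p` in characteristic `p`
(written in pure commutative algebra over Mathlib's `ValuationSubring`: every valuation ring
`O ⊇ k` of a finitely generated field extension `K/k`, `char k = p`, contains a finitely generated
`k`-subalgebra `A` with `Frac A = K` whose localisation at the centre `m_O ∩ A` is a regular local
ring) **and** the patching implication `LU_p → ResolutionInChar p`, the summit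
`ResolutionOfSingularities = ∀ p prime, ResolutionInChar.{0} p` follows by modus ponens.
The mathematics is in the two hypotheses; this file only records that the route closes.

(`import Mathlib`: the route's sibling signatures use `AlgebraicIndependent`, `Valuation.RankOne`, …;
the gate elaborates them in this file's context after every accept here, so keep the imports wide.)
-/

namespace Literature.AlgGeom

/-- Settles `stmt-ResolutionOfSingularities-0559` (route assembly): for every prime `p`, local
uniformization `LU_p` together with patching `LU_p → ResolutionInChar p` gives resolution of
singularities in characteristic `p`, hence the summit (`ResolutionOfSingularities_iff`; modus
ponens). [folklore] -/
theorem resolutionOfSingularities_of_localUniformization_and_patching :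
    (∀ p : ℕ, p.Prime → (∀ (k K : Type) [Field k] [CharP k p] [Field K] [Algebra k K], (⊤ : IntermediateField k K).FG → ∀ O : ValuationSubring K, (∀ c : k, algebraMap k K c ∈ O) → ∃ (A : Subalgebra k K) (h : A.toSubring ≤ O.toSubring), A.FG ∧ IsFractionRing A K ∧ IsRegularLocalRing (Localization.AtPrime (Ideal.comap (Subring.inclusion h) (IsLocalRing.maximalIdeal O)))) ∧ ((∀ (k K : Type) [Field k] [CharP k p] [Field K] [Algebra k K], (⊤ : IntermediateField k K).FG → ∀ O : ValuationSubring K, (∀ c : k, algebraMap k K c ∈ O) → ∃ (A : Subalgebra k K) (h : A.toSubring ≤ O.toSubring), A.FG ∧ IsFractionRing A K ∧ IsRegularLocalRing (Localization.AtPrime (Ideal.comap (Subring.inclusion h) (IsLocalRing.maximalIdeal O)))) → Literature.AlgebraicGeometry.Resolution.ResolutionInChar.{0} p)) → _root_.ResolutionOfSingularities :=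
  fun h p hp => (h p hp).2 (h p hp).1

/-! ### Relative form (route pivot, `stmt-ResolutionOfSingularities-0639`/`0640`) -/


/-- Settles `stmt-ResolutionOfSingularities-0640` (route assembly, relative form): for every prime
`p`, relative local uniformization `LUrel_p` together with patching `LUrel_p → ResolutionInChar p`
gives resolution of singularities in characteristic `p`, hence the summit (modus ponens;
`ResolutionOfSingularities` unfolds to `∀ p, p.Prime → ResolutionInChar p`). [folklore] -/
theorem resolutionOfSingularities_of_relLocalUniformization_and_patching :
    (∀ p : ℕ, p.Prime → (∀ (k K : Type) [Field k] [CharP k p] [Field K] [Algebra k K], (⊤ : IntermediateField k K).FG → ∀ O : ValuationSubring K, (∀ c : k, algebraMap k K c ∈ O) → ∀ R : Subalgebra k K, R.FG → R.toSubring ≤ O.toSubring → ∃ (A : Subalgebra k K) (h : A.toSubring ≤ O.toSubring), R ≤ A ∧ A.FG ∧ IsFractionRing A K ∧ IsRegularLocalRing (Localization.AtPrime (Ideal.comap (Subring.inclusion h) (IsLocalRing.maximalIdeal O)))) ∧ ((∀ (k K : Type) [Field k] [CharP k p] [Field K] [Algebra k K], (⊤ : IntermediateField k K).FG → ∀ O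 : ValuationSubring K, (∀ c : k, algebraMap k K c ∈ O) → ∀ R : Subalgebra k K, R.FG → R.toSubring ≤ O.toSubring → ∃ (A : Subalgebra k K) (h : A.toSubring ≤ O.toSubring), R ≤ A ∧ A.FG ∧ IsFractionRing A K ∧ IsRegularLocalRing (Localization.AtPrime (Ideal.comap (Subring.inclusion h) (IsLocalRing.maximalIdeal O)))) → Literature.AlgebraicGeometry.Resolution.ResolutionInChar.{0} p)) → _root_.ResolutionOfSingularities :=
  fun h p hp => (h p hp).2 (h p hp).1

/-- Bridge between the two forms of the route (relative ⇒ absolute local uniformization, for use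
with the absolute-form items 0558/0561): if every finitely generated `R ⊆ O` is dominated by a
regular-at-the-centre model, then some regular-at-the-centre model exists — apply the relative
statement to `R = ⊥ = k`, which lies in `O` because `k ⊆ O`. [folklore] -/
theorem localUniformization_of_rel (p : ℕ)
    (h : ∀ (k K : Type) [Field k] [CharP k p] [Field K] [Algebra k K], (⊤ : IntermediateField k K).FG → ∀ O : ValuationSubring K, (∀ c : k, algebraMap k K c ∈ O) → ∀ R : Subalgebra k K, R.FG → R.toSubring ≤ O.toSubring → ∃ (A : Subalgebra k K) (h : A.toSubring ≤ O.toSubring), R ≤ A ∧ A.FG ∧ IsFractionRing A K ∧ IsRegularLocalRing (Localization.AtPrime (Ideal.comap (Subring.inclusion h) (IsLocalRing.maximalIdeal O)))) :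
    ∀ (k K : Type) [Field k] [CharP k p] [Field K] [Algebra k K], (⊤ : IntermediateField k K).FG → ∀ O : ValuationSubring K, (∀ c : k, algebraMap k K c ∈ O) → ∃ (A : Subalgebra k K) (h : A.toSubring ≤ O.toSubring), A.FG ∧ IsFractionRing A K ∧ IsRegularLocalRing (Localization.AtPrime (Ideal.comap (Subring.inclusion h) (IsLocalRing.maximalIdeal O))) := by
  intro k K _ _ _ _ hK O hO
  have hbot : (⊥ : Subalgebra k K).toSubring ≤ O.toSubring := by
    intro x hx
    obtain ⟨c, rfl⟩ := Algebra.mem_bot.1 (show x ∈ (⊥ : Subalgebra k K) from hx)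
    exact hO c
  obtain ⟨A, hA, -, hfg, hfr, hreg⟩ := h k K hK O hO ⊥ Subalgebra.fg_bot hbot
  exact ⟨A, hA, hfg, hfr, hreg⟩

end Literature.AlgGeom
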